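import Mathlib

/-!
# FrobeniusJoin — the Frobenius join surface on the supersingular Fermat sextic fourfold (solo-blind s91)

Solo-blind programme, `work/s91/frobenius-join.md` (claims SB-C735 ff.); Mathlib only, nothing of the
programme's tree is imported; only the elementary algebra behind THEOREM FJ is formalised (no schemes,
no crystalline cohomology).

Informal setting.  `X̄ : x₀⁶ + ⋯ + x₅⁶ = 0` over `𝔽₅` (the Fermat sextic fourfold, supersingular since
`5 ≡ −1 mod 6`), `C : u₀⁶+u₁⁶+u₂⁶ = 0 ⊂ ℙ²`.  The FROBENIUS JOIN is the `𝔽₅`-rational ruled surface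
`S_Fr = closure {(l u₀ : l u₁ : l u₂ : m u₀⁵ : m u₁⁵ : m u₂⁵) : u ∈ C, (l:m) ∈ ℙ¹}`, the union of the
lines joining `u ∈ C ⊂ ℙ²_{012}` to its Frobenius image `Fr(u) ∈ C ⊂ ℙ²_{345}`.  In the note its crystalline
class is computed on the rank-5 symmetric piece `W₀`: it is `6h² + h₁e₁ + h₃e₃` with
`h₁ ∈ ℚ^× · Γ₅(1/3)⁻³`, `h₃ ∈ ℚ^× · 5Γ₅(2/3)⁻³` (Coleman's Frobenius constants of the Fermat curve,
LNM 1454 Thm 1.7, transported through Shioda's join correspondence), which proves block `(1,3)` of the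
programme's conjecture P-SSP on the `ℚ`-structure of supersingular Tate classes.

What is certified here:
* `frobeniusJoin_mem` : over any commutative ring of characteristic 5, `u₀⁶+u₁⁶+u₂⁶ = 0` implies
  `Σ (l uᵢ)⁶ + Σ (m uᵢ⁵)⁶ = 0` — the join of `u` and `Fr(u)` lies on the Fermat sextic (`S_Fr ⊂ X̄`);
* `star_decomposable_constant_char` : among the constant characters `(a,…,a)` of `μ₆` (the five lines of
  `W₀`), exactly `a ∈ {2,3,4}` admit a proper initial sub-sum `≡ 0 mod 6` (are reachable by Shioda's
  concatenation structure), and `curve_star_chars` : exactly `a ∈ {2,4}` split as `(a,a,a)∗(a,a,a)` with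
  `3a ≡ 0` — the two blocks the join of two CURVES can see; `(1⁶), (5⁶)` (block 04) cannot be reached;
* `colemanEps_values`, `frobenius_orbit_thirds` : the exponent bookkeeping in Coleman's formula
  `β_σ(q) = (−1)^{ε(q)} p^{ε(−σ⁻¹q)} Γ_p⟨r+s⟩/(Γ_p⟨r⟩Γ_p⟨s⟩)` at `p = 5`, `q` of order 3:
  `ε(1/3,1/3) = 0`, `ε(2/3,2/3) = 1`, `σ⁻¹(2/3,2/3) = (1/3,1/3)`, `−(1/3,1/3) = (2/3,2/3)` etc., so that
  `β_σ(2/3,2/3) = −5·Γ₅(1/3)Γ₅(2/3)⁻²` and `β_σ(1/3,1/3) = Γ₅(2/3)Γ₅(1/3)⁻²`;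
* `phi_eigen_block` : the `φ`-linear algebra on a swapped pair of lines (`φe₁ = c₁e₃`, `φe₃ = c₃e₁`):
  an eigenvector `h₁e₁ + h₃e₃` with eigenvalue `25` has `h₃ = c₁h₁/25`, and `h₁ ≠ 0 ⇒ c₁c₃ = 625`;
* `coeff_rational_of_pairings` : "rank one without Tate" — if `w·w = s ∈ ℚ^×` and `(a•w)·w = t ∈ ℚ` for a
  bilinear form over a `ℚ`-algebra field `K` (here `K = ℚ₅`), then `a = t/s ∈ ℚ`.

Consequences drawn in the note, not here: THEOREM FJ and its corollaries (P-SSP block 13 with the Frobenius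
join as generator; the 5-adic shadow of the `ψ = 10` Hodge class in block 13 is a rational multiple of the
Frobenius-join class iff the 13-digit identification SSQ-5 is exact).
-/

set_option linter.dupNamespace false

namespace Summit.HodgeConjecture.HodgeConjecture.Theorems

/-- `S_Fr ⊂ X̄`: in characteristic 5, if `u₀⁶+u₁⁶+u₂⁶ = 0` then the point `(l u : m Fr(u))`,
`Fr(u) = (u₀⁵,u₁⁵,u₂⁵)`, satisfies the Fermat sextic equation, for all `l, m`.  The proof is the
Frobenius identity `(a+b+c)⁵ = a⁵+b⁵+c⁵ + 5·(a+b)(b+c)(c+a)(a²+b²+c²+ab+bc+ca)`. -/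
theorem frobeniusJoin_mem {R : Type*} [CommRing R] [CharP R 5] (u₀ u₁ u₂ l m : R)
    (hC : u₀ ^ 6 + u₁ ^ 6 + u₂ ^ 6 = 0) :
    (l * u₀) ^ 6 + (l * u₁) ^ 6 + (l * u₂) ^ 6
      + (m * u₀ ^ 5) ^ 6 + (m * u₁ ^ 5) ^ 6 + (m * u₂ ^ 5) ^ 6 = 0 := by
  have h5 : (5 : R) = 0 := by exact_mod_cast CharP.cast_eq_zero R 5
  linear_combination
    (l ^ 6 + m ^ 6 * (u₀ ^ 6 + u₁ ^ 6 + u₂ ^ 6) ^ 4) * hC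
    - (m ^ 6 * ((u₀ ^ 6 + u₁ ^ 6) * (u₁ ^ 6 + u₂ ^ 6) * (u₂ ^ 6 + u₀ ^ 6)
        * ((u₀ ^ 6) ^ 2 + (u₁ ^ 6) ^ 2 + (u₂ ^ 6) ^ 2
            + u₀ ^ 6 * u₁ ^ 6 + u₁ ^ 6 * u₂ ^ 6 + u₂ ^ 6 * u₀ ^ 6))) * h5

/-- The Frobenius identity used above, recorded separately: in characteristic 5,
`(a+b+c)⁵ = a⁵ + b⁵ + c⁵`. -/
theorem frobenius_add_three {R : Type*} [CommRing R] [CharP R 5] (a b c : R) :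
    (a + b + c) ^ 5 = a ^ 5 + b ^ 5 + c ^ 5 := by
  have h5 : (5 : R) = 0 := by exact_mod_cast CharP.cast_eq_zero R 5
  linear_combination
    ((a + b) * (b + c) * (c + a) * (a ^ 2 + b ^ 2 + c ^ 2 + a * b + b * c + c * a)) * h5

/-- Shioda's concatenation ("∗") structure on constant characters of `μ₆`: the character `(a,a,a,a,a,a)`,
`a ≠ 0`, has a proper initial sub-sum `k·a ≡ 0 (mod 6)`, `1 ≤ k ≤ 5`, iff `a ∈ {2,3,4}`.  Hence the
lines `(1⁶)` and `(5⁶)` of `W₀` (block 04) are NOT reachable by any join/concatenation cycle. -/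
theorem star_decomposable_constant_char :
    ∀ a : ZMod 6, a ≠ 0 →
      ((∃ k : Fin 6, 0 < k.val ∧ ((k.val : ℕ) : ZMod 6) * a = 0) ↔ (a = 2 ∨ a = 3 ∨ a = 4)) := by
  decide

/-- The join of two CURVES `C × C' → X⁴` reaches the constant character `(a⁶)` iff it splits as
`(a,a,a)∗(a,a,a)` with `3a ≡ 0 (mod 6)`, i.e. iff `a ∈ {2,4}`: blocks 1 and 3 of `W₀` (`e₁ ↔ (2⁶)`,
`e₃ ↔ (4⁶)`), and only those. -/
theorem curve_star_chars : ∀ a : ZMod 6, (a ≠ 0 ∧ 3 * a = 0) ↔ (a = 2 ∨ a = 4) := by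
  decide

/-- Coleman's `ε(r,s) = ⟨r⟩ + ⟨s⟩ − ⟨r+s⟩`; for `r, s, r+s ∉ ℤ` one has `⟨x⟩ = fract x`, which is the
only case used. -/
def colemanEps (r s : ℚ) : ℚ := Int.fract r + Int.fract s - Int.fract (r + s)

/-- `fract(1/3) = 1/3`. -/
theorem fract_13 : Int.fract ((1 : ℚ) / 3) = 1 / 3 :=
  Int.fract_eq_iff.mpr ⟨by norm_num, by norm_num, 0, by norm_num⟩
/-- `fract(2/3) = 2/3`. -/
theorem fract_23 : Int.fract ((2 : ℚ) / 3) = 2 / 3 :=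
  Int.fract_eq_iff.mpr ⟨by norm_num, by norm_num, 0, by norm_num⟩
/-- `fract(4/3) = 1/3` (so `⟨2/3 + 2/3⟩ = 1/3`). -/
theorem fract_43 : Int.fract ((4 : ℚ) / 3) = 1 / 3 :=
  Int.fract_eq_iff.mpr ⟨by norm_num, by norm_num, 1, by norm_num⟩

/-- The two exponents in Coleman's Theorem 1.7 at the characters of order 3:
`ε(1/3,1/3) = 0` and `ε(2/3,2/3) = 1`.  With `frobenius_orbit_thirds` this gives
`β_σ(2/3,2/3) = (−1)¹·5¹·Γ₅(1/3)/Γ₅(2/3)²` (the holomorphic class goes to `5·unit` times the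
anti-holomorphic one, as Mazur's divisibility demands) and `β_σ(1/3,1/3) = Γ₅(2/3)/Γ₅(1/3)²` (a unit). -/
theorem colemanEps_values : colemanEps (1 / 3) (1 / 3) = 0 ∧ colemanEps (2 / 3) (2 / 3) = 1 := by
  unfold colemanEps
  rw [show (1 : ℚ) / 3 + 1 / 3 = 2 / 3 by norm_num, show (2 : ℚ) / 3 + 2 / 3 = 4 / 3 by norm_num,
    fract_13, fract_23, fract_43]
  norm_num

/-- Frobenius-orbit bookkeeping mod 1 at `p = 5` for thirds: `σ⁻¹q = 5q`, so `5·(2/3) ≡ 1/3`,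
`5·(1/3) ≡ 2/3`, and `−(1/3) ≡ 2/3`, `−(2/3) ≡ 1/3` (mod 1).  Hence `−σ⁻¹(2/3,2/3) = (2/3,2/3)` (ε = 1)
and `−σ⁻¹(1/3,1/3) = (1/3,1/3)` (ε = 0). -/
theorem frobenius_orbit_thirds :
    Int.fract (5 * ((2 : ℚ) / 3)) = 1 / 3 ∧ Int.fract (5 * ((1 : ℚ) / 3)) = 2 / 3 ∧
      Int.fract (-((1 : ℚ) / 3)) = 2 / 3 ∧ Int.fract (-((2 : ℚ) / 3)) = 1 / 3 := by
  refine ⟨?_, ?_, ?_, ?_⟩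
  · exact Int.fract_eq_iff.mpr ⟨by norm_num, by norm_num, 3, by norm_num⟩
  · exact Int.fract_eq_iff.mpr ⟨by norm_num, by norm_num, 1, by norm_num⟩
  · exact Int.fract_eq_iff.mpr ⟨by norm_num, by norm_num, -1, by norm_num⟩
  · exact Int.fract_eq_iff.mpr ⟨by norm_num, by norm_num, -1, by norm_num⟩

/-- `φ`-linear algebra on a swapped pair of lines of `W₀` (`φ e₁ = c₁ e₃`, `φ e₃ = c₃ e₁`): if
`h₁e₁ + h₃e₃` is a `φ`-eigenvector with eigenvalue `25` (the class of an `𝔽₅`-rational codimension-2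
cycle), i.e. `c₃h₃ = 25h₁` and `c₁h₁ = 25h₃`, then `h₃ = c₁h₁/25`, and if `h₁ ≠ 0` then `c₁c₃ = 625`.
(Over any field with `25 ≠ 0`; used with `K = ℚ₅`, `c₁ = 125Γ₅(1/3)⁶`, `c₃ = 5Γ₅(2/3)⁶`.) -/
theorem phi_eigen_block {K : Type*} [Field K] (c₁ c₃ h₁ h₃ : K) (h25 : (25 : K) ≠ 0)
    (e₁ : c₃ * h₃ = 25 * h₁) (e₃ : c₁ * h₁ = 25 * h₃) :
    h₃ = c₁ * h₁ / 25 ∧ (h₁ ≠ 0 → c₁ * c₃ = 625) := by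
  refine ⟨?_, fun hne => ?_⟩
  · rw [eq_div_iff h25]
    linear_combination (-1 : K) * e₃
  · have key : (c₁ * c₃ - 625) * h₁ = 0 := by
      linear_combination c₃ * e₃ + 25 * e₁
    rcases mul_eq_zero.mp key with h | h
    · exact sub_eq_zero.mp h
    · exact absurd h hne

/-- "Rank one without Tate": let `K` be a field containing `ℚ` (here `ℚ₅`), `B` a `K`-bilinear form
(the crystalline cup product), `w` a vector with `B w w = s ∈ ℚ^×` (the Frobenius-join class: its
self-intersection is a nonzero rational number) and `a • w` another vector on the same `K`-line whose
pairing with `w` is rational, `B (a•w) w = t ∈ ℚ` (an intersection number of `ℚ`-cycles).  Then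
`a = t/s ∈ ℚ`: the `ℚ`-span of cycle classes on the line is exactly `ℚ·w`. -/
theorem coeff_rational_of_pairings {K : Type*} [Field K] [Algebra ℚ K] {V : Type*} [AddCommGroup V]
    [Module K V] (B : V →ₗ[K] V →ₗ[K] K) (w : V) (a : K) (s t : ℚ) (hs : s ≠ 0)
    (hww : B w w = algebraMap ℚ K s) (hzw : B (a • w) w = algebraMap ℚ K t) :
    a = algebraMap ℚ K (t / s) := by
  rw [map_smul, LinearMap.smul_apply, smul_eq_mul, hww] at hzw
  have hs' : algebraMap ℚ K s ≠ 0 := (map_ne_zero (algebraMap ℚ K)).mpr hs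
  rw [map_div₀, ← hzw]
  field_simp

end Summit.HodgeConjecture.HodgeConjecture.Theorems
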